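import Literature.NumberTheory.Sieve.NumberFieldLargeSieveBilinear
import Literature.NumberTheory.Sieve.LogFourierSeparation
import Literature.NumberTheory.Sieve.PrimitiveReduction
import HarnessLib

/-!
# The large sieve for smoothly weighted bilinear forms (type II sums, Hinz 1988 (3.12)/(4.20))

Topic `Literature/NumberTheory/Sieve`, sub-namespace `TypeTwoLS`. The tree's bilinear large sieve
over a totally real field (`NumberFieldLS.bilinearLargeSieve`, Hinz (3.5)) bounds
`∑_{N𝔮 ≤ Q} (N𝔮/φ(𝔮)) ∑*_χ |∑_{α₁}∑_{α₂} d₁(α₁)d₂(α₂)χ(α₁α₂)|` for SEPARATED coefficients. In the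
type II sums of the Bombieri–Vinogradov theorem the coefficients carry the cross weight
`∏_w h_w(log σ_w α₁ + log σ_w α₂ − s_w)` (the smooth form of Hinz's condition
`|α₁^{(k)}α₂^{(k)}| ≤ z_k`, (3.9)); `LogSep.weightedNormSum_crossWeight_le` separates it at the
cost of `∏_w ‖ĥ_w‖₁`, because the large sieve bound only depends on `∑|d_i|²`, which is invariant
under unimodular twists. Everything is PROVED:

* `cw`, `cu` — weights `N𝔮/φ(𝔮)` and kernels `χ(α₁α₂)` on the index set `PrimRed.CharIdx`
  of pairs `(𝔮, χ)` (`PrimRed.primChars 𝔮` = the primitive characters as a `Finset`);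
* `bTerm_eq_sum_primChars`, `sum_bTerm_eq_weightedNormSum` — `∑_𝔮 bTerm` is a
  `LogSep.weightedNormSum` over `{(𝔮, χ)}`;
* `typeTwoLS` — **Hinz (3.12), smooth form**: for `Q ≥ 1`, nonzero ideals `𝔭₁, 𝔭₂`, finite
  `A_i ⊆ 𝔭_i` in cubes of side `2X_i` with `N𝔭_i ≤ X_i^d`, coefficients `c₁, c₂`, and
  `h_w ∈ C²_c(ℝ)`,
  `∑_{N𝔮≤Q,(𝔮,𝔭₁𝔭₂)=1} (N𝔮/φ(𝔮)) ∑*_χ |∑∑ c₁(α₁)c₂(α₂) ∏_w h_w(ℓ₁(α₁)_w + ℓ₂(α₂)_w − s_w) χ(α₁α₂)|`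
  `≤ C (∏_w ‖ĥ_w‖₁) √((Q² + X₁^d/N𝔭₁)∑|c₁|²) √((Q² + X₂^d/N𝔭₂)∑|c₂|²)`
  for arbitrary "coordinates" `ℓ₁, ℓ₂ : 𝓞_K → ℝ^{r₁}` and shifts `s` (in the application
  `ℓ(α)_w = log σ_w(α)`, `s_w = log(ρ₀^{(w)} M)`).

## References

* J. Hinz, *A generalization of Bombieri's prime number theorem to algebraic number fields*,
  Acta Arith. 51 (1988), §3 (3.5), (3.9)–(3.12); §4 (4.20). [cite: Hinz1988, §3 (3.12)]
-/

noncomputable section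

open Finset NumberField NumberField.InfinitePlace MeasureTheory
  Literature.NumberTheory.Sieve.NumberFieldLS Literature.NumberTheory.Sieve.LogSep
  Literature.NumberTheory.Sieve.BoxPrimes Literature.NumberTheory.LFunctions.NumberField
  Literature.NumberTheory.Sieve.PrimRed
open scoped Classical FourierTransform

namespace Literature.NumberTheory.Sieve.TypeTwoLS

variable {K : Type*} [Field K] [NumberField K]

/-! ## `∑_𝔮 bTerm` as a weighted norm sum over pairs `(𝔮, χ)` -/

variable (K) in
/-- The weights `N𝔮/φ(𝔮)`. [folklore] -/
def cw (j : CharIdx K) : ℝ := (Ideal.absNorm j.1 : ℝ) / Nat.card ((𝓞 K ⧸ j.1)ˣ)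

variable (K) in
/-- The kernels `χ(α₁α₂ mod 𝔮)`. [folklore] -/
def cu (j : CharIdx K) (α₁ α₂ : 𝓞 K) : ℂ := unitValue j.2 (Ideal.Quotient.mk j.1 (α₁ * α₂))

/-- The weights are nonnegative. [folklore] -/
theorem cw_nonneg (j : CharIdx K) : 0 ≤ cw K j := by unfold cw; positivity

/-- `bTerm` through `primChars`. [folklore] -/
theorem bTerm_eq_sum_primChars {𝔮 : Ideal (𝓞 K)} (h𝔮 : 𝔮 ≠ ⊥) (A₁ A₂ : Finset (𝓞 K))
    (F : 𝓞 K → 𝓞 K → ℂ) :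
    bTerm K 𝔮 A₁ A₂ F = (Ideal.absNorm 𝔮 : ℝ) / Nat.card ((𝓞 K ⧸ 𝔮)ˣ) *
      ∑ χ ∈ primChars K 𝔮, ‖∑ α₁ ∈ A₁, ∑ α₂ ∈ A₂, F α₁ α₂ * unitValue χ (Ideal.Quotient.mk 𝔮 (α₁ * α₂))‖ := by
  haveI : Finite (𝓞 K ⧸ 𝔮) := Ideal.finiteQuotientOfFreeOfNeBot 𝔮 h𝔮
  letI : Fintype (𝓞 K ⧸ 𝔮) := Fintype.ofFinite _
  rw [bTerm_eq, Nat.card_eq_fintype_card]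
  congr 1
  refine Finset.sum_congr ?_ fun _ _ => rfl
  ext χ
  rw [Finset.mem_filter, mem_primChars h𝔮]
  simp

/-- **`∑_{𝔮 ∈ 𝒬} bTerm` is a weighted norm sum over `{(𝔮, χ) : χ primitive}`.** [folklore] -/
theorem sum_bTerm_eq_weightedNormSum (𝒬 : Finset (Ideal (𝓞 K))) (h𝒬 : ∀ 𝔮 ∈ 𝒬, 𝔮 ≠ ⊥)
    (A₁ A₂ : Finset (𝓞 K)) (F : 𝓞 K → 𝓞 K → ℂ) :
    ∑ 𝔮 ∈ 𝒬, bTerm K 𝔮 A₁ A₂ F =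
      weightedNormSum (𝒬.sigma (primChars K)) (cw K) (cu K) A₁ A₂ F := by
  rw [weightedNormSum, Finset.sum_sigma]
  refine Finset.sum_congr rfl fun 𝔮 h𝔮 => ?_
  rw [bTerm_eq_sum_primChars (h𝒬 𝔮 h𝔮), Finset.mul_sum]
  rfl

/-! ## The type II large sieve with smooth cross weights -/

variable [IsTotallyReal K]

/-- **Hinz (3.12), smooth form.** See the file docstring. [cite: Hinz1988, §3 (3.5), (3.12)] -/
theorem typeTwoLS : ∃ C : ℝ, 0 < C ∧ ∀ (Q : ℝ), 1 ≤ Q → ∀ (𝔭₁ 𝔭₂ : Ideal (𝓞 K)), 𝔭₁ ≠ ⊥ → 𝔭₂ ≠ ⊥ →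
    ∀ (A₁ A₂ : Finset (𝓞 K)), (∀ α ∈ A₁, α ∈ 𝔭₁) → (∀ α ∈ A₂, α ∈ 𝔭₂) →
    ∀ (cen₁ cen₂ : {w : InfinitePlace K // w.IsReal} → ℝ) (X₁ X₂ : ℝ), 0 < X₁ → 0 < X₂ →
    (Ideal.absNorm 𝔭₁ : ℝ) ≤ X₁ ^ Module.finrank ℚ K → (Ideal.absNorm 𝔭₂ : ℝ) ≤ X₂ ^ Module.finrank ℚ K →
    (∀ α ∈ A₁, ∀ k, |remb K (α : K) k - cen₁ k| ≤ X₁) → (∀ α ∈ A₂, ∀ k, |remb K (α : K) k - cen₂ k| ≤ X₂) →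
    ∀ (c₁ c₂ : 𝓞 K → ℂ) (h : {w : InfinitePlace K // w.IsReal} → ℝ → ℂ),
    (∀ w, ContDiff ℝ 2 (h w)) → (∀ w, HasCompactSupport (h w)) →
    ∀ (ℓ₁ ℓ₂ : 𝓞 K → {w : InfinitePlace K // w.IsReal} → ℝ) (s : {w : InfinitePlace K // w.IsReal} → ℝ),
    ∑ 𝔮 ∈ (idealsLE K Q).filter (fun 𝔮 => IsCoprime 𝔮 𝔭₁ ∧ IsCoprime 𝔮 𝔭₂),
        bTerm K 𝔮 A₁ A₂ (fun α₁ α₂ => c₁ α₁ * c₂ α₂ * crossWeight h ℓ₁ ℓ₂ s α₁ α₂) ≤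
      C * (∏ w, ∫ τ, ‖𝓕 (h w) τ‖) *
        (Real.sqrt ((Q ^ 2 + X₁ ^ Module.finrank ℚ K / Ideal.absNorm 𝔭₁) * ∑ α ∈ A₁, ‖c₁ α‖ ^ 2) *
          Real.sqrt ((Q ^ 2 + X₂ ^ Module.finrank ℚ K / Ideal.absNorm 𝔭₂) * ∑ α ∈ A₂, ‖c₂ α‖ ^ 2)) := by
  obtain ⟨C, hC, hLS⟩ := bilinearLargeSieve (K := K)
  refine ⟨C, hC, ?_⟩
  intro Q hQ 𝔭₁ 𝔭₂ h𝔭₁ h𝔭₂ A₁ A₂ hA₁ hA₂ cen₁ cen₂ X₁ X₂ hX₁ hX₂ hN₁ hN₂ hbox₁ hbox₂ c₁ c₂ h hh hs ℓ₁ ℓ₂ s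
  set 𝒬 := (idealsLE K Q).filter (fun 𝔮 => IsCoprime 𝔮 𝔭₁ ∧ IsCoprime 𝔮 𝔭₂) with h𝒬
  have h𝒬0 : ∀ 𝔮 ∈ 𝒬, 𝔮 ≠ ⊥ := fun 𝔮 h => (mem_idealsLE.1 (Finset.mem_filter.1 h).1).1
  set B : ℝ := C * (Real.sqrt ((Q ^ 2 + X₁ ^ Module.finrank ℚ K / Ideal.absNorm 𝔭₁) * ∑ α ∈ A₁, ‖c₁ α‖ ^ 2) *
    Real.sqrt ((Q ^ 2 + X₂ ^ Module.finrank ℚ K / Ideal.absNorm 𝔭₂) * ∑ α ∈ A₂, ‖c₂ α‖ ^ 2)) with hB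
  -- the large sieve bound is uniform in unimodular twists
  have hBτ : ∀ θ₁ θ₂ : 𝓞 K → ℂ, (∀ α, ‖θ₁ α‖ = 1) → (∀ α, ‖θ₂ α‖ = 1) →
      weightedNormSum (𝒬.sigma (primChars K)) (cw K) (cu K) A₁ A₂
        (fun α₁ α₂ => (c₁ α₁ * θ₁ α₁) * (c₂ α₂ * θ₂ α₂)) ≤ B := by
    intro θ₁ θ₂ hθ₁ hθ₂
    rw [← sum_bTerm_eq_weightedNormSum 𝒬 h𝒬0]
    have h1 := hLS Q hQ 𝔭₁ 𝔭₂ h𝔭₁ h𝔭₂ A₁ A₂ hA₁ hA₂ cen₁ cen₂ X₁ X₂ hX₁ hX₂ hN₁ hN₂ hbox₁ hbox₂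
      (fun α => c₁ α * θ₁ α) (fun α => c₂ α * θ₂ α)
    have hn₁ : ∑ α ∈ A₁, ‖c₁ α * θ₁ α‖ ^ 2 = ∑ α ∈ A₁, ‖c₁ α‖ ^ 2 :=
      Finset.sum_congr rfl fun α _ => by rw [norm_mul, hθ₁, mul_one]
    have hn₂ : ∑ α ∈ A₂, ‖c₂ α * θ₂ α‖ ^ 2 = ∑ α ∈ A₂, ‖c₂ α‖ ^ 2 :=
      Finset.sum_congr rfl fun α _ => by rw [norm_mul, hθ₂, mul_one]
    rw [hn₁, hn₂] at h1
    rw [hB]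
    calc _ ≤ _ := h1
      _ = _ := by ring
  have hsep := weightedNormSum_crossWeight_le hh hs ℓ₁ ℓ₂ s (fun j _ => cw_nonneg j) (cu K) A₁ A₂ c₁ c₂ hBτ
  rw [← sum_bTerm_eq_weightedNormSum 𝒬 h𝒬0] at hsep
  calc _ ≤ B * ∏ w, ∫ τ, ‖𝓕 (h w) τ‖ := hsep
    _ = _ := by rw [hB]; ring

end Literature.NumberTheory.Sieve.TypeTwoLS
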